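import Summits.HodgeConjecture.HodgeConjecture.Theorems.LinearSystemTorelliMiddleDivisorSupportFourfoldOfPeriodDeficiency
import Summits.HodgeConjecture.HodgeConjecture.Theorems.LinearSystemTorelliMiddleDivisorSupportFourfoldStubConnectedWeakDescent
import Literature.AlgebraicGeometry.HodgeTheory.AlgebraicCyclesDefinedOverQbarProofs
import Literature.AlgebraicGeometry.FundamentalGroup.RiemannExistenceCovering

/-!
# Route `LinearSystemTorelli` — crux `MiddleDivisorSupportFourfold` (stmt-HodgeConjecture-2409):
# the residue of line `IdeatorFiveSketch` after the Charles–Schnell `ℚ̄`-support fact was DISCHARGED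

Helper file for the crux item stmt-HodgeConjecture-2409 (`--supports`; it closes nothing), line
`IdeatorFiveSketch` (idea `weakly-nonfactor-descent`), lead c7. Two tree events since lead c3's
assembly `linearSystemTorelli_middleDivisorSupportFourfold_of_periodDeficiency` (p119707: crux ⟸
stmt-11597 ∧ stmt-11595 ∧ stmt-11596 modulo FOUR named facts — BKU, Riemann existence with
`ℚ̄`-descent, Deligne's partie fixe, Charles–Schnell `ℚ̄`-supports) are integrated here:

1. the named fact `charlesSchnell2014_algebraicClasses_supportedOn_qbarClosed` is now PROVED in the
   tree (`charlesSchnell2014_algebraicClasses_supportedOn_qbarClosed_holds`,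
   `Literature/AlgebraicGeometry/HodgeTheory/AlgebraicCyclesDefinedOverQbarProofs.lean`, 2026-08-16T20:09Z:
   spreading the cycle out over `ℚ̄` and comparing slices), so the line's stub E (`ℚ̄`-rational
   divisor support of rational `(2,2)`-classes on smooth projective `W₀ ⊗_σ ℂ`) follows from
   `PeriodDeficiency.HodgeConjectureQbar` (stmt-11596) ALONE, indeed from its codimension-2 slice
   (`linearSystemTorelli_qbarDivisorSupportCodimTwo_of_hodgeConjectureQbar`,
   `…_of_hcQbarCodimTwo`);
2. the named fact C (`FundamentalGroup.riemannExistence_qbarDescent_of_finiteIndex`) is split into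
   Riemann's existence theorem over `ℂ` in covering form (the named fact
   `FundamentalGroup.riemannExistence_finiteCovering`, SGA1 XII 5.1) and CONNECTED weak descent of
   finite étale covers along `ℚ̄ ⊂ ℂ` (the consumed part of SGA1 XIII 4.6)
   (`linearSystemTorelli_riemannExistence_qbarDescent_of_finiteIndex_of_riemannExistence_of_connectedWeakDescent`,
   p124440).

Net statement (`linearSystemTorelli_middleDivisorSupportFourfold_of_lineResidue`, the registered
sub-goal; = skeleton v7 of `Cruxes/MiddleDivisorSupportFourfold/Lines/IdeatorFiveSketch.lean` with
its stub A replaced by its landed reduction p119481):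

  ClassicalGeometricVHS → QbarGenericIsHodgeGeneric → HodgeConjectureQbar →
    bku_finite_monodromyOrbit_of_isHodgeGenericIn → riemannExistence_finiteCovering →
    (connected weak descent) → deligne_globalInvariantCycles → MiddleDivisorSupportFourfold,

i.e. the crux is kernel-checked downstream of the three open items stmt-11597 / 11595 / 11596 of
route `PeriodDeficiency` and of exactly FOUR classical debts: BKU (finite monodromy of Hodge classes
at Hodge-generic points), Riemann existence over `ℂ`, connected weak `ℚ̄`-descent of finite étale
covers, and Deligne's global invariant cycle theorem (= route crux stmt-16363) — the Charles–Schnell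
fact and Fulton's pull-back fact having left the list.

## References

* [Voisin2007HodgeLoci] C. Voisin, Hodge loci and absolute Hodge classes, Compositio Math. 143
  (2007), §3, proof of Prop. 0.7.
* [CharlesSchnell2014Notes] F. Charles, C. Schnell, Notes on absolute Hodge classes (2014),
  Thm. 11.3.19 and Remark after Cor. 11.3.16.
* [SGA1] A. Grothendieck, M. Raynaud, SGA 1, Exp. XII Thm. 5.1; Exp. XIII Prop. 4.6.
* [DeligneHodgeII1971] P. Deligne, Théorie de Hodge II, Thm. 4.1.1.
* [BaldiKlinglerUllmo2024] G. Baldi, B. Klingler, E. Ullmo, On the distribution of the Hodge locus, §3.2.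
-/

-- every declaration of this problem lives in `Summit.HodgeConjecture.HodgeConjecture.…`
set_option linter.dupNamespace false

noncomputable section

namespace Summit.HodgeConjecture.HodgeConjecture.Theorems

open CategoryTheory AlgebraicGeometry
open _root_.Topology
open Summit.HodgeConjecture.HodgeConjecture.Theses
open Literature.AlgebraicGeometry Literature.AlgebraicGeometry.Motives
open Literature.AlgebraicGeometry.HodgeTheory

/-- **Stub E from the codimension-2 slice of the Hodge conjecture over `ℚ̄` alone** (for one fixed
`σ`): if rational `(2,2)`-classes on every smooth projective `W₀ ⊗_σ ℂ` are algebraic, each of them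
dies off the preimage of a proper Zariski-closed `Z₀ ⊊ W₀` — the tree's
`linearSystemTorelli_qbarDivisorSupport_of_hcQbarCodimTwo` (p117963) with its Charles–Schnell input
supplied by the DISCHARGED `charlesSchnell2014_algebraicClasses_supportedOn_qbarClosed_holds`.
[cite: CharlesSchnell2014Notes, Remark after Cor. 11.3.16] -/
theorem linearSystemTorelli_qbarDivisorSupportCodimTwo_of_hcQbarCodimTwo (σ : AlgebraicClosure ℚ →+* ℂ)
    (hQ : ∀ ⦃m : ℕ⦄ ⦃W₀ : SchemeOver (AlgebraicClosure ℚ)⦄,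
      IsSmoothProjective m ((baseChangeHom σ).obj W₀) →
        ∀ (c' : complexBetti ((baseChangeHom σ).obj W₀) 4), IsRationalClass c' →
          IsOfHodgeType m ((baseChangeHom σ).obj W₀) 4 2 2 c' →
            c' ∈ algebraicClasses ((baseChangeHom σ).obj W₀) 2) :
    ∀ ⦃m : ℕ⦄ (W₀ : SchemeOver (AlgebraicClosure ℚ)), IsSmoothProjective m ((baseChangeHom σ).obj W₀) →
      ∀ (c' : complexBetti ((baseChangeHom σ).obj W₀) 4), IsRationalClass c' →
        IsOfHodgeType m ((baseChangeHom σ).obj W₀) 4 2 2 c' →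
          ∃ Z₀ : Set W₀.left, IsClosed Z₀ ∧ Z₀ ≠ Set.univ ∧
            complexBetti.restrictCompl ((baseChangeHom σ).obj W₀)
              ((baseChangeHomFst σ W₀).base ⁻¹' Z₀) 4 c' = 0 :=
  linearSystemTorelli_qbarDivisorSupport_of_hcQbarCodimTwo
    charlesSchnell2014_algebraicClasses_supportedOn_qbarClosed_holds σ hQ

/-- **Stub E ⟸ `PeriodDeficiency.HodgeConjectureQbar` (stmt-11596) alone** — the line's sanity
reduction `stub_qbarDivisorSupportCodimTwo_of_hodgeConjectureQbar` of skeleton v6 with the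
Charles–Schnell hypothesis discharged. [cite: CharlesSchnell2014Notes, Remark after Cor. 11.3.16] -/
theorem linearSystemTorelli_qbarDivisorSupportCodimTwo_of_hodgeConjectureQbar
    (h : PeriodDeficiency.HodgeConjectureQbar) :
    ∀ (σ : AlgebraicClosure ℚ →+* ℂ) ⦃m : ℕ⦄ (W₀ : SchemeOver (AlgebraicClosure ℚ)),
      IsSmoothProjective m ((baseChangeHom σ).obj W₀) →
      ∀ (c' : complexBetti ((baseChangeHom σ).obj W₀) 4), IsRationalClass c' →
        IsOfHodgeType m ((baseChangeHom σ).obj W₀) 4 2 2 c' →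
          ∃ Z₀ : Set W₀.left, IsClosed Z₀ ∧ Z₀ ≠ Set.univ ∧
            complexBetti.restrictCompl ((baseChangeHom σ).obj W₀)
              ((baseChangeHomFst σ W₀).base ⁻¹' Z₀) 4 c' = 0 :=
  fun σ ↦ linearSystemTorelli_qbarDivisorSupport_of_hodgeConjectureQbar
    charlesSchnell2014_algebraicClasses_supportedOn_qbarClosed_holds h σ

/-- **stmt-2409 ⟸ route `PeriodDeficiency` modulo FOUR classical debts** (registered sub-goal of
the crux; kernel-checked form of skeleton v7 of line `IdeatorFiveSketch` with stub A replaced by its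
landed reduction): the crux `MiddleDivisorSupportFourfold` follows from
`PeriodDeficiency.ClassicalGeometricVHS` (stmt-11597), `PeriodDeficiency.QbarGenericIsHodgeGeneric`
(stmt-11595) and `PeriodDeficiency.HodgeConjectureQbar` (stmt-11596), modulo the named facts
`bku_finite_monodromyOrbit_of_isHodgeGenericIn`, `FundamentalGroup.riemannExistence_finiteCovering`
(SGA1 XII 5.1), `deligne_globalInvariantCycles` (Hodge II 4.1.1) and the CONNECTED weak descent of
finite étale covers along `ℚ̄ ⊂ ℂ` (the consumed part of SGA1 XIII 4.6) — Voisin's `ℚ̄`-funnel for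
divisor support with the glue, the Charles–Schnell `ℚ̄`-support fact, Hironaka over `ℚ̄`, the
classification of coverings and the quasi-projectivity of the covers all PROVED in the tree.
[cite: Voisin2007HodgeLoci, §3, proof of Prop. 0.7] [cite: CharlesSchnell2014Notes, Thm. 11.3.19]
[cite: SGA1, Exp. XII Thm. 5.1 and Exp. XIII Prop. 4.6] [cite: DeligneHodgeII1971, Thm. 4.1.1] -/
theorem linearSystemTorelli_middleDivisorSupportFourfold_of_lineResidue :
    Summit.HodgeConjecture.HodgeConjecture.Theses.PeriodDeficiency.ClassicalGeometricVHS →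
    Summit.HodgeConjecture.HodgeConjecture.Theses.PeriodDeficiency.QbarGenericIsHodgeGeneric →
    Summit.HodgeConjecture.HodgeConjecture.Theses.PeriodDeficiency.HodgeConjectureQbar →
    Literature.AlgebraicGeometry.HodgeTheory.bku_finite_monodromyOrbit_of_isHodgeGenericIn →
    Literature.AlgebraicGeometry.FundamentalGroup.riemannExistence_finiteCovering →
    (∀ (σ : AlgebraicClosure ℚ →+* ℂ) (S₀ : SchemeOver (AlgebraicClosure ℚ)), IsQuasiProjectiveOver S₀ →
      IrreducibleSpace S₀.left → AlgebraicGeometry.Smooth S₀.hom →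
      ∀ ⦃S' : SchemeOver ℂ⦄ (g : S' ⟶ (baseChangeHom σ).obj S₀), IsFinite g.left → Etale g.left →
        IrreducibleSpace S'.left → ConnectedSpace (ComplexPoints S') →
        ∃ (S''₀ : SchemeOver (AlgebraicClosure ℚ)) (g₀ : S''₀ ⟶ S₀)
          (Ψ : ComplexPoints ((baseChangeHom σ).obj S''₀) ≃ₜ ComplexPoints S'), IsFinite g₀.left ∧
          Etale g₀.left ∧ ∀ z, AlgPoints.map g (Ψ z) = AlgPoints.map ((baseChangeHom σ).map g₀) z) →
    Literature.AlgebraicGeometry.HodgeTheory.deligne_globalInvariantCycles →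
    Summit.HodgeConjecture.HodgeConjecture.Theses.LinearSystemTorelli.MiddleDivisorSupportFourfold := by
  intro hC hG hQ hB hR hWD hD
  obtain ⟨σ⟩ := exists_ringHom_algebraicClosure_rat_complex
  exact linearSystemTorelli_middleDivisorSupportFourfold_of_dominantQbarEnvelope_of_hodgeConjectureQbar
    charlesSchnell2014_algebraicClasses_supportedOn_qbarClosed_holds hQ σ
    (linearSystemTorelli_dominantQbarEnvelopeFourfoldCodimTwo_of_qbarGenericIsHodgeGeneric hC hG hB
      (linearSystemTorelli_riemannExistence_qbarDescent_of_finiteIndex_of_riemannExistence_of_connectedWeakDescent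
        hR hWD) hD σ)

/-- **The same with only the codimension-2 slice of the Hodge conjecture over `ℚ̄`** (for one fixed
`σ`): rational `(2,2)`-classes on every smooth projective `W₀ ⊗_σ ℂ` algebraic — the exact `ℚ̄`-side
residue of the crux along this line, now without the Charles–Schnell hypothesis.
[cite: Voisin2007HodgeLoci, §3, proof of Prop. 0.7] [cite: CharlesSchnell2014Notes, Thm. 11.3.19] -/
theorem linearSystemTorelli_middleDivisorSupportFourfold_of_lineResidue_of_hcQbarCodimTwo
    (hC : PeriodDeficiency.ClassicalGeometricVHS) (hG : PeriodDeficiency.QbarGenericIsHodgeGeneric)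
    (hB : bku_finite_monodromyOrbit_of_isHodgeGenericIn)
    (hR : Literature.AlgebraicGeometry.FundamentalGroup.riemannExistence_finiteCovering)
    (hWD : ∀ (σ : AlgebraicClosure ℚ →+* ℂ) (S₀ : SchemeOver (AlgebraicClosure ℚ)),
      IsQuasiProjectiveOver S₀ → IrreducibleSpace S₀.left → AlgebraicGeometry.Smooth S₀.hom →
      ∀ ⦃S' : SchemeOver ℂ⦄ (g : S' ⟶ (baseChangeHom σ).obj S₀), IsFinite g.left → Etale g.left →
        IrreducibleSpace S'.left → ConnectedSpace (ComplexPoints S') →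
        ∃ (S''₀ : SchemeOver (AlgebraicClosure ℚ)) (g₀ : S''₀ ⟶ S₀)
          (Ψ : ComplexPoints ((baseChangeHom σ).obj S''₀) ≃ₜ ComplexPoints S'), IsFinite g₀.left ∧
          Etale g₀.left ∧ ∀ z, AlgPoints.map g (Ψ z) = AlgPoints.map ((baseChangeHom σ).map g₀) z)
    (hD : deligne_globalInvariantCycles) (σ : AlgebraicClosure ℚ →+* ℂ)
    (hQ2 : ∀ ⦃m : ℕ⦄ ⦃W₀ : SchemeOver (AlgebraicClosure ℚ)⦄,
      IsSmoothProjective m ((baseChangeHom σ).obj W₀) →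
        ∀ (c' : complexBetti ((baseChangeHom σ).obj W₀) 4), IsRationalClass c' →
          IsOfHodgeType m ((baseChangeHom σ).obj W₀) 4 2 2 c' →
            c' ∈ algebraicClasses ((baseChangeHom σ).obj W₀) 2) :
    LinearSystemTorelli.MiddleDivisorSupportFourfold :=
  linearSystemTorelli_middleDivisorSupportFourfold_of_dominantQbarEnvelope σ
    (linearSystemTorelli_dominantQbarEnvelopeFourfoldCodimTwo_of_qbarGenericIsHodgeGeneric hC hG hB
      (linearSystemTorelli_riemannExistence_qbarDescent_of_finiteIndex_of_riemannExistence_of_connectedWeakDescent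
        hR hWD) hD σ)
    (linearSystemTorelli_qbarDivisorSupportCodimTwo_of_hcQbarCodimTwo σ hQ2)

end Summit.HodgeConjecture.HodgeConjecture.Theorems

end
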